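import Summits.NavierStokesRegularity.NavierStokesRegularity.Theorems.OddMorawetzLocal.Negative.OddMorawetzLocalRefutationDefs
import HarnessLib

/-!
# Crux `OddMorawetzLocal` (stmt-NavierStokesRegularity-1376) — functoriality, homogeneity and linearity of the
action and derivation matrices

Support file for the refutation skeleton of `OddMorawetzLocal` (line `registered`, lead c1), registered stub
`act_functorial`.  Mathlib `List` / `Matrix` / `RingHom` API only; no named facts; nothing is defined.

Every coefficient produced by the list algebra of `OddMorawetzLocalJetAlgebra.lean` /
`OddMorawetzLocalRefutationDefs.lean` (`idxImages`, `actVar`, `mul`, `prodList`, `subst`, `act`, `derVar`,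
`der`) is a polynomial expression in the matrix entries assembled by `map` / `flatMap` with `*` and the
constant `1`, and `coeffOf` is a sum of such coefficients.  Hence

* `act_map_ringHom`, `actMatrix_map` — a ring homomorphism `f : R →+* S` of the coefficients passes through
  the substitution action and its matrix (`actMatrix k (g.map f) = (actMatrix k g).map f`);
* `act_smul_matrix` — homogeneity: on a monomial `m` the action of `c • g` is the action of `g` scaled by
  `c ^ (m.length + monoWeight m)` (one factor `c` for the component entry and one per derivative index of every
  variable);
* `der_map_ringHom`, `derMatrix_map` — the same functoriality for the derivation `der L` and `derMatrix k L`;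
* `derMatrix_smul` — the derivation matrix is linear in `L`: `derMatrix k (c • L) = c • derMatrix k L`;
* `coeffOf_derP` — the zero-pruned kernel twin `derP` has the same coefficients as `der`;

assembled into the registered seven-part conjunction `act_functorial`.
-/

noncomputable section

set_option linter.dupNamespace false
set_option autoImplicit false

namespace Summit.NavierStokesRegularity.NavierStokesRegularity.Theorems.OddMorawetz

variable {R S : Type} [CommRing R] [CommRing S]

/-! ### `coeffOf` on `[]`, `t :: p`, `p ++ q`, `flatMap` -/

/-- `coeffOf` of a cons: the head contributes its coefficient iff it carries the monomial. -/
private theorem coeffOf_cons (t : R × List JVar) (p : JPoly R) (m : List JVar) :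
    JPoly.coeffOf (t :: p) m = (if t.2 = m then t.1 else 0) + JPoly.coeffOf p m := by
  by_cases h : t.2 = m <;> simp [JPoly.coeffOf, h]

/-- `coeffOf` is additive under concatenation. -/
private theorem coeffOf_append (p q : JPoly R) (m : List JVar) :
    JPoly.coeffOf (p ++ q) m = JPoly.coeffOf p m + JPoly.coeffOf q m := by
  simp [JPoly.coeffOf, List.filter_append, List.map_append, List.sum_append]

/-- `coeffOf` of a `flatMap` is the sum of the `coeffOf`s. -/
private theorem coeffOf_flatMap {α : Type} (l : List α) (F : α → JPoly R) (m : List JVar) :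
    JPoly.coeffOf (l.flatMap F) m = (l.map fun x => JPoly.coeffOf (F x) m).sum := by
  induction l with
  | nil => simp [JPoly.coeffOf]
  | cons x l ih => simp only [List.flatMap_cons, coeffOf_append, ih, List.map_cons, List.sum_cons]

/-- `coeffOf` commutes with a ring homomorphism of the coefficients. -/
private theorem coeffOf_map_ringHom (f : R →+* S) (q : JPoly R) (m : List JVar) :
    JPoly.coeffOf (q.map fun t => (f t.1, t.2)) m = f (JPoly.coeffOf q m) := by
  induction q with
  | nil => simp [JPoly.coeffOf]
  | cons t q ih =>
    simp only [List.map_cons, coeffOf_cons, ih, map_add]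
    split_ifs <;> simp

/-- `coeffOf` of a polynomial with all coefficients scaled by `c` is `c *` the coefficient. -/
private theorem coeffOf_map_scale (c : R) (q : JPoly R) (m : List JVar) :
    JPoly.coeffOf (q.map fun t => (c * t.1, t.2)) m = c * JPoly.coeffOf q m := by
  induction q with
  | nil => simp [JPoly.coeffOf]
  | cons t q ih =>
    simp only [List.map_cons, coeffOf_cons, ih]
    split_ifs <;> ring

/-! ### Functoriality of the substitution action in the coefficient ring -/

/-- `idxImages` commutes with a ring homomorphism of the matrix entries. -/
private theorem idxImages_map_ringHom (f : R →+* S) (g : Matrix (Fin 3) (Fin 3) R) (l : List (Fin 3)) :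
    JPoly.idxImages (g.map f) l = (JPoly.idxImages g l).map fun cj => (f cj.1, cj.2) := by
  induction l with
  | nil => simp [JPoly.idxImages]
  | cons i is ih =>
    simp only [JPoly.idxImages, ih, List.map_flatMap, List.map_map, Function.comp_def, Matrix.map_apply,
      map_mul]

/-- `actVar` commutes with a ring homomorphism of the matrix entries. -/
private theorem actVar_map_ringHom (f : R →+* S) (g : Matrix (Fin 3) (Fin 3) R) (v : JVar) :
    JPoly.actVar (g.map f) v = (JPoly.actVar g v).map fun t => (f t.1, t.2) := by
  simp only [JPoly.actVar, idxImages_map_ringHom, List.map_flatMap, List.map_map, Function.comp_def,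
    Matrix.map_apply, map_mul]

/-- `mul` commutes with a ring homomorphism of the coefficients. -/
private theorem mul_map_ringHom (f : R →+* S) (p q : JPoly R) :
    JPoly.mul (p.map fun t => (f t.1, t.2)) (q.map fun t => (f t.1, t.2)) =
      (JPoly.mul p q).map fun t => (f t.1, t.2) := by
  simp only [JPoly.mul, List.flatMap_map, List.map_flatMap, List.map_map, Function.comp_def, map_mul]

/-- `prodList` of coefficient-mapped factors is the coefficient-mapped `prodList`. -/
private theorem prodList_map_ringHom (f : R →+* S) (σ : JVar → JPoly R) (m : List JVar) :
    JPoly.prodList (m.map fun v => (σ v).map fun t => (f t.1, t.2)) =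
      (JPoly.prodList (m.map σ)).map fun t => (f t.1, t.2) := by
  induction m with
  | nil => simp [JPoly.prodList]
  | cons v m ih => simp only [List.map_cons, JPoly.prodList, ih, mul_map_ringHom]

/-- `subst` commutes with a ring homomorphism of the coefficients (substituting mapped polynomials). -/
private theorem subst_map_ringHom (f : R →+* S) (σ : JVar → JPoly R) (p : JPoly R) :
    JPoly.subst (fun v => (σ v).map fun t => (f t.1, t.2)) (p.map fun t => (f t.1, t.2)) =
      (JPoly.subst σ p).map fun t => (f t.1, t.2) := by
  simp only [JPoly.subst, List.flatMap_map, List.map_flatMap, List.map_map, Function.comp_def, map_mul]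
  congr 1
  funext t
  rw [prodList_map_ringHom, List.map_map]
  simp only [Function.comp_def]

/-- **Functoriality of the action** (part 1): `act (g.map f) (p.map f) = (act g p).map f`. -/
theorem act_map_ringHom (f : R →+* S) (g : Matrix (Fin 3) (Fin 3) R) (p : JPoly R) :
    JPoly.act (g.map f) (p.map fun t => (f t.1, t.2)) = (JPoly.act g p).map fun t => (f t.1, t.2) := by
  have h : JPoly.actVar (g.map f) = fun v => (JPoly.actVar g v).map fun t => (f t.1, t.2) :=
    funext (actVar_map_ringHom f g)
  simp only [JPoly.act, h, subst_map_ringHom, List.map_map, Function.comp_def]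

/-- **Functoriality of the action matrix** (part 2): `actMatrix k (g.map f) = (actMatrix k g).map f`. -/
theorem actMatrix_map (f : R →+* S) (k : ℕ) (g : Matrix (Fin 3) (Fin 3) R) :
    actMatrix k (g.map f) = (actMatrix k g).map f := by
  ext i j
  simp only [actMatrix, Matrix.map_apply, Matrix.of_apply]
  calc JPoly.coeffOf (JPoly.act (g.map f) [(1, (idx k).get j)]) ((idx k).get i)
      = JPoly.coeffOf (JPoly.act (g.map f)
          (([(1, (idx k).get j)] : JPoly R).map fun t => (f t.1, t.2))) ((idx k).get i) := by simp
    _ = f (JPoly.coeffOf (JPoly.act g [(1, (idx k).get j)]) ((idx k).get i)) := by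
        rw [act_map_ringHom, coeffOf_map_ringHom]

/-! ### Homogeneity of the substitution action -/

/-- In `idxImages (c • g) l` every coefficient is `c ^ l.length` times the corresponding one of `idxImages g l`. -/
private theorem idxImages_smul (c : R) (g : Matrix (Fin 3) (Fin 3) R) (l : List (Fin 3)) :
    JPoly.idxImages (c • g) l = (JPoly.idxImages g l).map fun cj => (c ^ l.length * cj.1, cj.2) := by
  induction l with
  | nil => simp [JPoly.idxImages]
  | cons i is ih =>
    simp only [JPoly.idxImages, ih, List.map_flatMap, List.map_map, Function.comp_def, Matrix.smul_apply,
      smul_eq_mul, List.length_cons]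
    congr 1
    funext j
    congr 1
    funext cj
    simp only [Prod.mk.injEq, and_true]
    ring

/-- `actVar (c • g) v` is `actVar g v` scaled by `c ^ (|v.2| + 1)`. -/
private theorem actVar_smul (c : R) (g : Matrix (Fin 3) (Fin 3) R) (v : JVar) :
    JPoly.actVar (c • g) v = (JPoly.actVar g v).map fun t => (c ^ (v.2.length + 1) * t.1, t.2) := by
  simp only [JPoly.actVar, idxImages_smul, List.map_flatMap, List.map_map, Function.comp_def,
    Matrix.smul_apply, smul_eq_mul]
  congr 1
  funext b
  congr 1
  funext cj
  simp only [Prod.mk.injEq, and_true]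
  ring

/-- `mul` of scaled polynomials is the scaled `mul`. -/
private theorem mul_map_scale (d e : R) (p q : JPoly R) :
    JPoly.mul (p.map fun t => (d * t.1, t.2)) (q.map fun t => (e * t.1, t.2)) =
      (JPoly.mul p q).map fun t => (d * e * t.1, t.2) := by
  simp only [JPoly.mul, List.flatMap_map, List.map_flatMap, List.map_map, Function.comp_def]
  congr 1
  funext s
  congr 1
  funext t
  simp only [Prod.mk.injEq, and_true]
  ring

/-- The product of the variable images under `c • g` is the product under `g` scaled by
`c ^ (m.length + monoWeight m)`. -/
private theorem prodList_actVar_smul (c : R) (g : Matrix (Fin 3) (Fin 3) R) (m : List JVar) :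
    JPoly.prodList (m.map (JPoly.actVar (c • g))) =
      (JPoly.prodList (m.map (JPoly.actVar g))).map fun t => (c ^ (m.length + monoWeight m) * t.1, t.2) := by
  induction m with
  | nil => simp [JPoly.prodList, monoWeight]
  | cons v m ih =>
    simp only [List.map_cons, JPoly.prodList, ih, actVar_smul, mul_map_scale, List.length_cons, monoWeight,
      List.sum_cons]
    congr 1
    funext t
    simp only [Prod.mk.injEq, and_true]
    ring

/-- **Homogeneity of the action** (part 3): on a monomial `m`, `act (c • g) = c ^ (|m| + monoWeight m) • act g`. -/
theorem act_smul_matrix (c a : R) (g : Matrix (Fin 3) (Fin 3) R) (m : List JVar) :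
    JPoly.act (c • g) [(a, m)] =
      (JPoly.act g [(a, m)]).map fun t => (c ^ (m.length + monoWeight m) * t.1, t.2) := by
  simp only [JPoly.act, JPoly.subst, List.flatMap_cons, List.flatMap_nil, List.append_nil,
    prodList_actVar_smul, List.map_map, Function.comp_def]
  congr 1
  funext s
  simp only [Prod.mk.injEq, and_true]
  ring

/-! ### Functoriality and linearity of the derivation -/

/-- `derVar` commutes with a ring homomorphism of the matrix entries. -/
private theorem derVar_map_ringHom (f : R →+* S) (L : Matrix (Fin 3) (Fin 3) R) (v : JVar) :
    JPoly.derVar (L.map f) v = (JPoly.derVar L v).map fun t => (f t.1, t.2) := by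
  simp only [JPoly.derVar, List.map_append, List.map_map, List.map_flatMap, Function.comp_def,
    Matrix.map_apply]

/-- **Functoriality of the derivation** (part 4): `der (L.map f) (p.map f) = (der L p).map f`. -/
theorem der_map_ringHom (f : R →+* S) (L : Matrix (Fin 3) (Fin 3) R) (p : JPoly R) :
    JPoly.der (L.map f) (p.map fun t => (f t.1, t.2)) = (JPoly.der L p).map fun t => (f t.1, t.2) := by
  simp only [JPoly.der, derVar_map_ringHom, List.flatMap_map, List.map_flatMap, List.map_map,
    Function.comp_def, map_mul]

/-- **Functoriality of the derivation matrix** (part 5): `derMatrix k (L.map f) = (derMatrix k L).map f`. -/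
theorem derMatrix_map (f : R →+* S) (k : ℕ) (L : Matrix (Fin 3) (Fin 3) R) :
    derMatrix k (L.map f) = (derMatrix k L).map f := by
  ext i j
  simp only [derMatrix, Matrix.map_apply, Matrix.of_apply]
  calc JPoly.coeffOf (JPoly.der (L.map f) [(1, (idx k).get j)]) ((idx k).get i)
      = JPoly.coeffOf (JPoly.der (L.map f)
          (([(1, (idx k).get j)] : JPoly R).map fun t => (f t.1, t.2))) ((idx k).get i) := by simp
    _ = f (JPoly.coeffOf (JPoly.der L [(1, (idx k).get j)]) ((idx k).get i)) := by
        rw [der_map_ringHom, coeffOf_map_ringHom]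

/-- `derVar` is linear in `L`: `derVar (c • L) v = c • derVar L v`. -/
private theorem derVar_smul (c : R) (L : Matrix (Fin 3) (Fin 3) R) (v : JVar) :
    JPoly.derVar (c • L) v = (JPoly.derVar L v).map fun t => (c * t.1, t.2) := by
  simp only [JPoly.derVar, List.map_append, List.map_map, List.map_flatMap, Function.comp_def,
    Matrix.smul_apply, smul_eq_mul]

/-- `der` is linear in `L`: `der (c • L) p = c • der L p`. -/
private theorem der_smul (c : R) (L : Matrix (Fin 3) (Fin 3) R) (p : JPoly R) :
    JPoly.der (c • L) p = (JPoly.der L p).map fun t => (c * t.1, t.2) := by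
  simp only [JPoly.der, derVar_smul, List.map_flatMap, List.map_map, Function.comp_def]
  congr 1
  funext t
  congr 1
  funext s
  congr 1
  funext cw
  simp only [Prod.mk.injEq, and_true]
  ring

/-- **Linearity of the derivation matrix** (part 6): `derMatrix k (c • L) = c • derMatrix k L`. -/
theorem derMatrix_smul (k : ℕ) (c : R) (L : Matrix (Fin 3) (Fin 3) R) :
    derMatrix k (c • L) = c • derMatrix k L := by
  ext i j
  simp only [derMatrix, Matrix.smul_apply, Matrix.of_apply, smul_eq_mul, der_smul, coeffOf_map_scale]

/-! ### The zero-pruned derivation has the same coefficients -/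

/-- Dropping the zero-coefficient terms of a list before a coefficient-respecting map does not change any
`coeffOf`. -/
private theorem coeffOf_map_filter_ne_zero [DecidableEq R] {α : Type} (l : List (R × α))
    (χ : R × α → R × List JVar) (hχ : ∀ cw, cw.1 = 0 → (χ cw).1 = 0) (m : List JVar) :
    JPoly.coeffOf ((l.filter fun t => t.1 ≠ 0).map χ) m = JPoly.coeffOf (l.map χ) m := by
  induction l with
  | nil => rfl
  | cons cw l ih =>
    rw [List.filter_cons]
    by_cases hz : cw.1 = 0
    · rw [if_neg (by simpa using hz), ih, List.map_cons, coeffOf_cons, hχ cw hz, ite_self, zero_add]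
    · rw [if_pos (by simpa using hz), List.map_cons, List.map_cons, coeffOf_cons, coeffOf_cons, ih]

/-- **The pruned derivation** (part 7): `derP L q` and `der L q` have the same coefficients. -/
theorem coeffOf_derP [DecidableEq R] (L : Matrix (Fin 3) (Fin 3) R) (q : JPoly R) (m : List JVar) :
    JPoly.coeffOf (JPoly.derP L q) m = JPoly.coeffOf (JPoly.der L q) m := by
  simp only [JPoly.derP, JPoly.der, JPoly.derVarP, coeffOf_flatMap]
  congr 1
  refine List.map_congr_left fun t _ => ?_
  congr 1
  refine List.map_congr_left fun s _ => ?_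
  exact coeffOf_map_filter_ne_zero _ _ (fun cw h => by simp [h]) _

/-! ### Assembly -/

/-- **Registered stub `act_functorial`** of the refutation skeleton of `OddMorawetzLocal`: the substitution action
and the derivation (and their matrices on the monomial basis `idx k`) are functorial in the coefficient ring,
the action is homogeneous of degree `|m| + monoWeight m` on a monomial `m`, the derivation matrix is linear in
`L`, and the zero-pruned kernel derivation `derP` has the coefficients of `der`. -/
theorem act_functorial :
    (∀ {R S : Type} [CommRing R] [CommRing S] (f : R →+* S) (g : Matrix (Fin 3) (Fin 3) R) (p : JPoly R),
      JPoly.act (g.map f) (p.map fun t => (f t.1, t.2)) = (JPoly.act g p).map fun t => (f t.1, t.2)) ∧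
    (∀ {R S : Type} [CommRing R] [CommRing S] (f : R →+* S) (k : ℕ) (g : Matrix (Fin 3) (Fin 3) R),
      actMatrix k (g.map f) = (actMatrix k g).map f) ∧
    (∀ {R : Type} [CommRing R] (c a : R) (g : Matrix (Fin 3) (Fin 3) R) (m : List JVar),
      JPoly.act (c • g) [(a, m)] = (JPoly.act g [(a, m)]).map fun t => (c ^ (m.length + monoWeight m) * t.1, t.2)) ∧
    (∀ {R S : Type} [CommRing R] [CommRing S] (f : R →+* S) (L : Matrix (Fin 3) (Fin 3) R) (p : JPoly R),
      JPoly.der (L.map f) (p.map fun t => (f t.1, t.2)) = (JPoly.der L p).map fun t => (f t.1, t.2)) ∧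
    (∀ {R S : Type} [CommRing R] [CommRing S] (f : R →+* S) (k : ℕ) (L : Matrix (Fin 3) (Fin 3) R),
      derMatrix k (L.map f) = (derMatrix k L).map f) ∧
    (∀ {R : Type} [CommRing R] (k : ℕ) (c : R) (L : Matrix (Fin 3) (Fin 3) R),
      derMatrix k (c • L) = c • derMatrix k L) ∧
    (∀ {R : Type} [CommRing R] [DecidableEq R] (L : Matrix (Fin 3) (Fin 3) R) (q : JPoly R) (m : List JVar),
      JPoly.coeffOf (JPoly.derP L q) m = JPoly.coeffOf (JPoly.der L q) m) :=
  ⟨fun f g p => act_map_ringHom f g p, fun f k g => actMatrix_map f k g, fun c a g m => act_smul_matrix c a g m,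
    fun f L p => der_map_ringHom f L p, fun f k L => derMatrix_map f k L, fun k c L => derMatrix_smul k c L,
    fun L q m => coeffOf_derP L q m⟩

end Summit.NavierStokesRegularity.NavierStokesRegularity.Theorems.OddMorawetz

end
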